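import Summits.BirchSwinnertonDyer.BirchSwinnertonDyer.Theorems.KatoDescentPotSupersingularWildConjAResidueCartanRows08
import Summits.BirchSwinnertonDyer.BirchSwinnertonDyer.Theorems.KatoDescentTamePotSupersingularCartanMuRoadRealDoorsNoGrowth
import HarnessLib

/-!
# Route `KatoDescentPotSupersingular` (rung K9, O6 wild `p = 3`, cell `bsd-potss`) — COURTESY re-record by seat `bsd-potss-k8t-c4` g22 of the `3Nn`
# Conj-A residue rows of `KatoDescentPotSupersingularWildConjAResidueCartanRows08` with Coates–Sujatha Thm. 3.4 DISCHARGED and Iwasawa's growth theorem REMOVED: (A) at `(E,3)` and U₀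
# `MissingUpperBoundAt E 3` modulo Ferrero–Washington ALONE (+ `hKatoA hGZK hmod` for U₀) and ONE classical `μ = 0` input on `ℚ(P) = ℚ(E[3])⁺`
# (`--supports stmt-BirchSwinnertonDyer-19197 --as helper`; closes nothing)

HONEST FRAMING. Route-free THEOREMS ONLY (no definition, no named fact, no `sorry`). The k9-c4 records in `KatoDescentPotSupersingularWildConjAResidueCartanRows08` display `hCS hI hFW` (+ U₀ inputs);
`CoatesSujatha2005.thm34_…_holds` (k8t-c4 g22, p694085) and the hI-free doors `CartanMuRoadRealDoorsNoGrowth` (p696870) leave ONLY `hFW`: named-fact debt −2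
per theorem. Kernel certificates (`irr_…`, `classO6_…`, `hasModPImageEqNonsplitCartanNormalizer_…` where certified) are REUSED from the tree, not restated;
displayed data (Cremona's `r_an = 0`, the image equality where displayed, `c`, `hμ`) unchanged. Per row; nothing booked; (A) / BSD proved for no curve.
[cite: CoatesSujatha2005, Thm. 3.4 (§3)] [cite: Kato2004Asterisque, Thm. 14.5 (3) (p. 236)] [cite: Washington1997, §13.1, §13.3 Prop. 13.23] [cite: Cremona2006, Table 1]
-/

set_option autoImplicit false
set_option linter.dupNamespace false

noncomputable section

open scoped Classical NumberField
open Polynomial WeierstrassCurve NumberField Field IntermediateField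
  Literature.NumberTheory.EllipticCurves Literature.NumberTheory.EllipticCurves.Rank1Residual
  Literature.NumberTheory.EllipticCurves.Rank1Residual.Typed
  Literature.NumberTheory.GaloisRepresentations Literature.NumberTheory.SerreUniformity Literature.NumberTheory.IwasawaTheory
  Summit.BirchSwinnertonDyer.Rank1Residual Summit.BirchSwinnertonDyer.Rank1Residual.Additive
  Summit.BirchSwinnertonDyer.BirchSwinnertonDyer.Theorems
  Summit.BirchSwinnertonDyer.BirchSwinnertonDyer.Theorems.TameUpperUnitTwistRecords

namespace Summit.BirchSwinnertonDyer.BirchSwinnertonDyer.Theorems.WildUpperUnitTwistRecords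

/-- **(A) at `(112455bk1, 3)` from ONE classical `μ`-hypothesis on `ℚ(P) = ℚ(E[3])⁺`, modulo Ferrero–Washington ALONE** (Coates–Sujatha 3.4 discharged, no growth
theorem; door `CartanMuRoadRealDoorsNoGrowth`; kernel certificates reused). CONDITIONAL; (A) asserted for no curve. [cite: CoatesSujatha2005, Thm. 3.4 (§3)]
[cite: Washington1997, §13.3 Prop. 13.23] [cite: Cremona2006, Table 1 (Cremona label 112455bk1)] -/
theorem conjA_g112455bk1_3_noGrowth
    (hFW : ferreroWashington1979_classicalMuVanishes)
    {W : WeierstrassCurve ℚ} [W.IsElliptic] (hWeq : W = (⟨1, (-1), 0, (-12324300), 16726248125⟩ : WeierstrassCurve ℚ)) (himg : HasModPImageEqNonsplitCartanNormalizer W 3)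
    {c : absoluteGaloisGroup ℚ} (hc : IsComplexConjugation (Rat.castHom ℝ) c)
    (hμ : ∀ κE : ZpExtension ↥(fixedField (Subgroup.zpowers (absRestrictNormalHom (W.divisionField 3) c))) 3,
      κE.IsCyclotomic → ClassicalMuVanishes κE)
    (κ : ZpExtension ℚ 3) (hκ : κ.IsCyclotomic) :
    ∃ (γ : absoluteGaloisGroup ℚ) (Df : W.FineSelmerDualData κ γ),
      Module.Finite ℤ_[3] (RestrictScalars ℤ_[3] (IwasawaAlgebra 3) Df.X) := by
  subst hWeq
  exact CartanMuRoadRealDoorsNoGrowth.conjA_three_of_hasModPImageEqNonsplitCartanNormalizer_of_realMu _ hFW himg hc hμ κ hκ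

/-- **RECORD — UPPER half `ord₃ #Ш(E) ≤ ord₃ #Ш(E)_an` for `E = 112455bk1` at `p = 3` (O6 wild), modulo `hKatoA hGZK hmod hFW` ONLY** (Coates–Sujatha 3.4
discharged, growth theorem removed; kernel certificates reused; Cremona's `r_an = 0` displayed). Per row; nothing booked; BSD is not proved by this.
[cite: Kato2004Asterisque, Thm. 14.5 (3) (p. 236)] [cite: CoatesSujatha2005, Thm. 3.4 (§3)] [cite: Cremona2006, Table 1 (Cremona label 112455bk1)] -/
theorem missingUpperBoundAt_g112455bk1_3_noGrowth
    (hKatoA : Kato2004.rankZero_padicValNat_sha_add_padicValNat_tamagawa_le_of_additive_potGood_of_irreducible_of_fineSelmerDual_fg)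
    (hGZK : rank_eq_analyticRank_of_analyticRank_le_one) (hmod : hasEntireLFunction_rat)
    (hFW : ferreroWashington1979_classicalMuVanishes)
    {W : WeierstrassCurve ℚ} [W.IsElliptic] [W.IsGloballyMinimal] (hWeq : W = (⟨1, (-1), 0, (-12324300), 16726248125⟩ : WeierstrassCurve ℚ)) (hr : W.analyticRank = 0)
    (himg : HasModPImageEqNonsplitCartanNormalizer W 3)
    {c : absoluteGaloisGroup ℚ} (hc : IsComplexConjugation (Rat.castHom ℝ) c)
    (hμ : ∀ κE : ZpExtension ↥(fixedField (Subgroup.zpowers (absRestrictNormalHom (W.divisionField 3) c))) 3,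
      κE.IsCyclotomic → ClassicalMuVanishes κE) :
    MissingUpperBoundAt W 3 := by
  subst hWeq
  haveI : Fact (Nat.Prime 3) := ⟨Nat.prime_three⟩
  exact CartanMuRoadRealDoorsNoGrowth.missingUpperBoundAt_three_wild_of_hasModPImageEqNonsplitCartanNormalizer_of_realMu _ hKatoA hGZK
    hmod hFW hr classO6_g112455bk1_3 irr_g112455bk1_3 himg hc hμ

/-- **(A) at `(117747bf1, 3)` from ONE classical `μ`-hypothesis on `ℚ(P) = ℚ(E[3])⁺`, modulo Ferrero–Washington ALONE** (Coates–Sujatha 3.4 discharged, no growth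
theorem; door `CartanMuRoadRealDoorsNoGrowth`; kernel certificates reused). CONDITIONAL; (A) asserted for no curve. [cite: CoatesSujatha2005, Thm. 3.4 (§3)]
[cite: Washington1997, §13.3 Prop. 13.23] [cite: Cremona2006, Table 1 (Cremona label 117747bf1)] -/
theorem conjA_g117747bf1_3_noGrowth
    (hFW : ferreroWashington1979_classicalMuVanishes)
    {W : WeierstrassCurve ℚ} [W.IsElliptic] (hWeq : W = (⟨0, 0, 1, (-3334802751), 74123053896764⟩ : WeierstrassCurve ℚ)) (himg : HasModPImageEqNonsplitCartanNormalizer W 3)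
    {c : absoluteGaloisGroup ℚ} (hc : IsComplexConjugation (Rat.castHom ℝ) c)
    (hμ : ∀ κE : ZpExtension ↥(fixedField (Subgroup.zpowers (absRestrictNormalHom (W.divisionField 3) c))) 3,
      κE.IsCyclotomic → ClassicalMuVanishes κE)
    (κ : ZpExtension ℚ 3) (hκ : κ.IsCyclotomic) :
    ∃ (γ : absoluteGaloisGroup ℚ) (Df : W.FineSelmerDualData κ γ),
      Module.Finite ℤ_[3] (RestrictScalars ℤ_[3] (IwasawaAlgebra 3) Df.X) := by
  subst hWeq
  exact CartanMuRoadRealDoorsNoGrowth.conjA_three_of_hasModPImageEqNonsplitCartanNormalizer_of_realMu _ hFW himg hc hμ κ hκ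

/-- **RECORD — UPPER half `ord₃ #Ш(E) ≤ ord₃ #Ш(E)_an` for `E = 117747bf1` at `p = 3` (O6 wild), modulo `hKatoA hGZK hmod hFW` ONLY** (Coates–Sujatha 3.4
discharged, growth theorem removed; kernel certificates reused; Cremona's `r_an = 0` displayed). Per row; nothing booked; BSD is not proved by this.
[cite: Kato2004Asterisque, Thm. 14.5 (3) (p. 236)] [cite: CoatesSujatha2005, Thm. 3.4 (§3)] [cite: Cremona2006, Table 1 (Cremona label 117747bf1)] -/
theorem missingUpperBoundAt_g117747bf1_3_noGrowth
    (hKatoA : Kato2004.rankZero_padicValNat_sha_add_padicValNat_tamagawa_le_of_additive_potGood_of_irreducible_of_fineSelmerDual_fg)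
    (hGZK : rank_eq_analyticRank_of_analyticRank_le_one) (hmod : hasEntireLFunction_rat)
    (hFW : ferreroWashington1979_classicalMuVanishes)
    {W : WeierstrassCurve ℚ} [W.IsElliptic] [W.IsGloballyMinimal] (hWeq : W = (⟨0, 0, 1, (-3334802751), 74123053896764⟩ : WeierstrassCurve ℚ)) (hr : W.analyticRank = 0)
    (himg : HasModPImageEqNonsplitCartanNormalizer W 3)
    {c : absoluteGaloisGroup ℚ} (hc : IsComplexConjugation (Rat.castHom ℝ) c)
    (hμ : ∀ κE : ZpExtension ↥(fixedField (Subgroup.zpowers (absRestrictNormalHom (W.divisionField 3) c))) 3,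
      κE.IsCyclotomic → ClassicalMuVanishes κE) :
    MissingUpperBoundAt W 3 := by
  subst hWeq
  haveI : Fact (Nat.Prime 3) := ⟨Nat.prime_three⟩
  exact CartanMuRoadRealDoorsNoGrowth.missingUpperBoundAt_three_wild_of_hasModPImageEqNonsplitCartanNormalizer_of_realMu _ hKatoA hGZK
    hmod hFW hr classO6_g117747bf1_3 irr_g117747bf1_3 himg hc hμ

end Summit.BirchSwinnertonDyer.BirchSwinnertonDyer.Theorems.WildUpperUnitTwistRecords

end
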